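import Summits.QuantumFields.QCD.Theorems.QuarksAsStableActionWilsonQuarkStabilityStubCellGauge

/-!
# N-generic cell regauging
(helper for crux stmt-QuantumFields-9307 `…WilsonQuarkChessboard.FlatCellOptimal`, line `registered`,
stub `stub_cellGaugeAllN`, G3)

For every colour number `N`, every torus `(ℤ/L)⁴` with `L ≥ 4`, every `U(N)` field `V` and every
corner `c` some gauge `g` makes the total deficit `Σ (N - Re tr (g • V)_ℓ)` of the 32 links
`(c + ε, μ)`, `ε ∈ {0,1}⁴`, `ε_μ = 0`, of the closed unit hypercube at `c` at most `C ×` the total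
deficit `Σ (N - Re tr V_p)` of its 24 plaquettes `(c + ε; μ < ν)`, `ε_μ = ε_ν = 0`, with the
N-INDEPENDENT constant `C = 1920` (no smallness assumption).

This is the sibling line's `stub_cellGauge`
(`Theorems/QuarksAsStableActionWilsonQuarkStabilityStubCellGauge.lean`, `U(3)`) with `Fin 3 ↦ Fin N`;
the proof is the same and uses nothing about `N = 3`:
`g` is the REVERSE-LEXICOGRAPHIC TREE GAUGE (holonomy of the path from `c` along axis `0`, then
`1, 2, 3`; `exists_treeGauge`, definition-free), gauging the tree links `(c + q, μ)`, `q_i = 0 ∀ i > μ`,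
to `1`; a non-tree cell link is moved onto the tree along the axes `ν > μ` with `q_ν = 1`, largest
first, by the transport identity `W(y + ν̂, μ) = (g(y) V_p(y; μ, ν) g(y)⁻¹)⁻¹ W(y, μ)`
(`gaugeTransform_shift_eq`), each of the `≤ 3` steps costing one cell plaquette through the N-free
algebra `N - Re tr (AB) ≤ 2 (N - Re tr A) + 2 (N - Re tr B)` for unitaries (`0 ≤ tr Zᴴ Z`,
`Z = (1 - Aᴴ) + (1 - B)`, i.e. `‖1 - AB‖_F² ≤ 2‖1 - A‖_F² + 2‖1 - B‖_F²`) and the invariance of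
`Re tr` under inversion and conjugation (`link_bound`: deficit `≤ (2^{k+1} - 2) S` once the axes `≥ k`
are cleared, `S` the plaquette sum; `30 S` per link); the link filter injects into `{0,1}⁴ × Fin 4`,
so `C = 64 · 30`.  All auxiliary lemmas are private copies of the sibling file's private lemmas with
`3 ↦ N` (they are not exported there).  Pure theorem file (no `def`s).
-/

namespace Summit.QuantumFields.QCD.Cruxes.FlatCellOptimal.CellGauge

open Literature.MathematicalPhysics Literature.MathematicalPhysics.QuantumLattice
  Literature.MathematicalPhysics.QuantumFieldTheory
open Matrix Complex
open scoped ComplexOrder ComplexConjugate BigOperators Matrix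

noncomputable section

/-! ### Trace deficits of unitary matrices (all `N`) -/

/-- `Re tr W ≤ N` for a unitary `W` (every entry has norm at most `1`). -/
private theorem re_trace_le_of_mem_unitaryGroup {N : ℕ} {W : Matrix (Fin N) (Fin N) ℂ}
    (hW : W ∈ Matrix.unitaryGroup (Fin N) ℂ) : W.trace.re ≤ N := by
  -- adapted from `QuarksAsStableActionWilsonQuarkStabilityStubCellGauge.lean` (private there)
  rw [Matrix.trace, Complex.re_sum]
  calc ∑ i, (Matrix.diag W i).re ≤ ∑ _i : Fin N, (1 : ℝ) := Finset.sum_le_sum fun i _ =>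
        (Complex.re_le_norm _).trans (entry_norm_bound_of_unitary hW i i)
    _ = N := by simp

/-- The trace inequality `N - Re tr (A B) ≤ 2 (N - Re tr A) + 2 (N - Re tr B)` for unitary `A, B`:
`0 ≤ tr Zᴴ Z = 6N - 4 Re tr A - 4 Re tr B + 2 Re tr (AB)` for `Z = (1 - Aᴴ) + (1 - B)` (this is
`‖1 - AB‖_F² ≤ 2‖1 - A‖_F² + 2‖1 - B‖_F²`). -/
private theorem deficit_mul_le {N : ℕ} {A B : Matrix (Fin N) (Fin N) ℂ}
    (hA : A ∈ Matrix.unitaryGroup (Fin N) ℂ) (hB : B ∈ Matrix.unitaryGroup (Fin N) ℂ) :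
    (N : ℝ) - (A * B).trace.re ≤ 2 * ((N : ℝ) - A.trace.re) + 2 * ((N : ℝ) - B.trace.re) := by
  -- adapted from `QuarksAsStableActionWilsonQuarkStabilityStubCellGauge.lean` (private there)
  have hA' : A * Aᴴ = 1 := by
    simpa only [star_eq_conjTranspose] using Matrix.mem_unitaryGroup_iff.mp hA
  have hB' : Bᴴ * B = 1 := by
    simpa only [star_eq_conjTranspose] using Matrix.mem_unitaryGroup_iff'.mp hB
  have hpos : 0 ≤ (((1 - Aᴴ) + (1 - B))ᴴ * ((1 - Aᴴ) + (1 - B))).trace.re :=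
    (Complex.nonneg_iff.mp (Matrix.posSemidef_conjTranspose_mul_self _).trace_nonneg).1
  have hexp : ((1 - Aᴴ) + (1 - B))ᴴ * ((1 - Aᴴ) + (1 - B)) =
      (1 + 1 - A - Aᴴ) + (1 - A - B + A * B) + (1 - Aᴴ - Bᴴ + Bᴴ * Aᴴ) + (1 + 1 - B - Bᴴ) := by
    rw [conjTranspose_add, conjTranspose_sub, conjTranspose_sub, conjTranspose_one,
      conjTranspose_conjTranspose]
    have e : ((1 : Matrix (Fin N) (Fin N) ℂ) - A + (1 - Bᴴ)) * (1 - Aᴴ + (1 - B)) =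
        (1 + 1 - A - Aᴴ) + (1 - A - B + A * B) + (1 - Aᴴ - Bᴴ + Bᴴ * Aᴴ) + (1 + 1 - B - Bᴴ) +
          (A * Aᴴ - 1) + (Bᴴ * B - 1) := by
      noncomm_ring
    rw [e, hA', hB', sub_self, add_zero, add_zero]
  have hre : ∀ X : Matrix (Fin N) (Fin N) ℂ, Xᴴ.trace.re = X.trace.re := fun X => by
    rw [trace_conjTranspose, Complex.star_def, Complex.conj_re]
  have h3 : (Bᴴ * Aᴴ).trace.re = (A * B).trace.re := by
    rw [← conjTranspose_mul, trace_conjTranspose, Complex.star_def, Complex.conj_re]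
  rw [hexp] at hpos
  simp only [trace_add, trace_sub, trace_one, Fintype.card_fin, Complex.add_re, Complex.sub_re,
    Complex.natCast_re, hre, h3] at hpos
  linarith

/-- Deficits are non-negative on `U(N)`: `0 ≤ N - Re tr W`. -/
private theorem deficit_nonneg {N : ℕ} (W : unitaryGroup (Fin N) ℂ) :
    0 ≤ (N : ℝ) - (W : Matrix (Fin N) (Fin N) ℂ).trace.re := by
  have h := re_trace_le_of_mem_unitaryGroup W.2
  linarith

/-- The trace inequality on `U(N)`: `N - Re tr (P W) ≤ 2 (N - Re tr P) + 2 (N - Re tr W)`. -/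
private theorem deficit_mul_le' {N : ℕ} (P W : unitaryGroup (Fin N) ℂ) :
    (N : ℝ) - ((P * W : unitaryGroup (Fin N) ℂ) : Matrix (Fin N) (Fin N) ℂ).trace.re ≤
      2 * ((N : ℝ) - (P : Matrix (Fin N) (Fin N) ℂ).trace.re) +
        2 * ((N : ℝ) - (W : Matrix (Fin N) (Fin N) ℂ).trace.re) := by
  have h := deficit_mul_le P.2 W.2
  rwa [Submonoid.coe_mul]

/-- `Re tr` is invariant under conjugation in `U(N)` (cyclicity of the trace). -/
private theorem re_trace_conj {N : ℕ} (T W : unitaryGroup (Fin N) ℂ) :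
    ((T * W * T⁻¹ : unitaryGroup (Fin N) ℂ) : Matrix (Fin N) (Fin N) ℂ).trace.re =
      (W : Matrix (Fin N) (Fin N) ℂ).trace.re := by
  rw [Submonoid.coe_mul, Submonoid.coe_mul, Matrix.trace_mul_cycle, Matrix.UnitaryGroup.inv_apply,
    Matrix.UnitaryGroup.star_mul_self, Matrix.one_mul]

/-- `Re tr W⁻¹ = Re tr W` in `U(N)` (`W⁻¹ = Wᴴ`). -/
private theorem re_trace_inv {N : ℕ} (W : unitaryGroup (Fin N) ℂ) :
    ((W⁻¹ : unitaryGroup (Fin N) ℂ) : Matrix (Fin N) (Fin N) ℂ).trace.re =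
      (W : Matrix (Fin N) (Fin N) ℂ).trace.re := by
  rw [Matrix.UnitaryGroup.inv_apply, star_eq_conjTranspose, trace_conjTranspose, Complex.star_def,
    Complex.conj_re]

/-! ### The tree gauge and the transport identity (any gauge group) -/

/-- **The reverse-lexicographic tree gauge on a cell (definition-free form).**  For every `U` and
corner `c` there is a gauge `g` — the holonomy of the path from `c` along axis `0`, then `1`, `2`, `3` —
gauging to `1` every link `(c + q, μ)`, `q ∈ {0,1}⁴`, `q_μ = 0`, with `q_i = 0` for all `i > μ`. -/
private theorem exists_treeGauge {G : Type*} [Group G] {L : ℕ} (hL : 4 ≤ L) (U : GaugeConfig 4 L G)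
    (c : Site 4 L) :
    ∃ g : Site 4 L → G, ∀ (q : Fin 4 → ℕ) (μ : Fin 4), (∀ i, q i ≤ 1) → q μ = 0 →
      (∀ i, μ < i → q i = 0) → gaugeTransform g U (c + (fun i => (q i : ZMod L)), μ) = 1 := by
  -- adapted from `exists_treeGauge` of `QuarksAsStableActionWilsonQuarkStabilityStubCellGauge.lean`
  -- (Summits/QuantumFields/QCD/Theorems; private there; tree rooted at the corner)
  let foot : (Fin 4 → ℕ) → Fin 4 → Fin 4 → ℕ := fun m k i => if i < k then m i else 0
  let A : (Fin 4 → ℕ) → Fin 4 → G := fun m k =>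
    if m k = 1 then U (c + (fun i => (foot m k i : ZMod L)), k) else 1
  let comb : (Fin 4 → ℕ) → G := fun m => A m 0 * A m 1 * A m 2 * A m 3
  refine ⟨fun z => comb (fun i => (z i - c i).val), fun q μ hq hqμ htree => ?_⟩
  have hval : ∀ m : Fin 4 → ℕ, (∀ i, m i < L) →
      (fun i => (((c + fun j => (m j : ZMod L)) i - c i).val)) = m := fun m hm => by
    funext i; simp only [Pi.add_apply, add_sub_cancel_left]; exact ZMod.val_cast_of_lt (hm i)
  have hqL : ∀ i, q i < L := fun i => by have := hq i; omega
  have hq' : ∀ i, (q + Pi.single μ 1 : Fin 4 → ℕ) i < L := fun i => by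
    by_cases h : i = μ
    · subst h; simp [hqμ]; omega
    · have := hq i; simp [Pi.single_eq_of_ne h]; omega
  have hshift : (c + fun i => ((q + Pi.single μ 1 : Fin 4 → ℕ) i : ZMod L)) =
      QuantumFieldTheory.Site.shift (c + fun i => (q i : ZMod L)) μ := by
    simp only [QuantumFieldTheory.Site.shift]; rw [add_assoc]; congr 1; funext i
    by_cases h : i = μ
    · subst h; simp
    · simp [Pi.single_eq_of_ne h]
  -- the feet of the axes `k ≤ μ` do not see the step
  have hfoot : ∀ k, k ≤ μ → foot (q + Pi.single μ 1) k = foot q k := by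
    intro k hk; funext i; simp only [foot]
    by_cases hik : i < k
    · simp [hik, Pi.single_eq_of_ne (lt_of_lt_of_le hik hk).ne]
    · simp [hik]
  have hlt : ∀ k, k < μ → A (q + Pi.single μ 1) k = A q k := by
    intro k hk
    have : (q + Pi.single μ 1 : Fin 4 → ℕ) k = q k := by simp [Pi.single_eq_of_ne hk.ne]
    simp only [A]; rw [hfoot k hk.le, this]
  have hgt : ∀ k, μ < k → A q k = 1 := fun k hk => by simp only [A]; rw [htree k hk]; simp
  have hgt' : ∀ k, μ < k → A (q + Pi.single μ 1) k = 1 := by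
    intro k hk
    have e : (q + Pi.single μ 1 : Fin 4 → ℕ) k = 0 := by simp [Pi.single_eq_of_ne hk.ne', htree k hk]
    simp only [A]; rw [e]; simp
  have hμA : A q μ = 1 := by simp only [A]; rw [hqμ]; simp
  have hself : A (q + Pi.single μ 1) μ = U (c + (fun i => (q i : ZMod L)), μ) := by
    have h1 : (q + Pi.single μ 1 : Fin 4 → ℕ) μ = 1 := by simp [hqμ]
    have hf : (fun i => ((foot q μ i : ℕ) : ZMod L)) = fun i => ((q i : ℕ) : ZMod L) := by
      funext i; simp only [foot]
      by_cases hi : i < μ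
      · rw [if_pos hi]
      · rw [if_neg hi]
        rcases (not_lt.mp hi).lt_or_eq with hlt' | heq
        · rw [htree i hlt']
        · rw [← heq, hqμ]
    simp only [A]; rw [h1, if_pos rfl, hfoot μ le_rfl]
    exact congrArg (fun f : Fin 4 → ZMod L => U (c + f, μ)) hf
  -- the comb extends by the link
  have hcomb : comb (q + Pi.single μ 1) = comb q * U (c + (fun i => (q i : ZMod L)), μ) := by
    simp only [comb]
    obtain ⟨k, hk⟩ := μ
    interval_cases k
    · have e : (⟨0, hk⟩ : Fin 4) = 0 := rfl
      simp only [e] at hself hgt hgt' hμA ⊢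
      rw [hself, hμA, hgt' 1 (by decide), hgt' 2 (by decide), hgt' 3 (by decide), hgt 1 (by decide),
        hgt 2 (by decide), hgt 3 (by decide)]
      simp only [mul_one, one_mul]
    · have e : (⟨1, hk⟩ : Fin 4) = 1 := rfl
      simp only [e] at hself hlt hgt hgt' hμA ⊢
      rw [hlt 0 (by decide), hself, hμA, hgt' 2 (by decide), hgt' 3 (by decide), hgt 2 (by decide),
        hgt 3 (by decide)]
      simp only [mul_one]
    · have e : (⟨2, hk⟩ : Fin 4) = 2 := rfl
      simp only [e] at hself hlt hgt hgt' hμA ⊢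
      rw [hlt 0 (by decide), hlt 1 (by decide), hself, hμA, hgt' 3 (by decide), hgt 3 (by decide)]
      simp only [mul_one]
    · have e : (⟨3, hk⟩ : Fin 4) = 3 := rfl
      simp only [e] at hself hlt hμA ⊢
      rw [hlt 0 (by decide), hlt 1 (by decide), hlt 2 (by decide), hself, hμA]
      simp only [mul_one]
  simp only [gaugeTransform]
  rw [← hshift, hval q hqL, hval _ hq', hcomb, mul_inv_cancel]

/-- **Transport identity.**  If the two `ν`-links `(y, ν)` and `(y + μ̂, ν)` are gauged to `1`, then
`W(y + ν̂, μ) = (g(y) U_p(y; μ, ν) g(y)⁻¹)⁻¹ · W(y, μ)` for the gauge-transformed links `W = g • U`. -/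
private theorem gaugeTransform_shift_eq {G : Type*} [Group G] {d L : ℕ} (g : Site d L → G)
    (U : GaugeConfig d L G) (y : Site d L) (μ ν : Fin d) (h1 : gaugeTransform g U (y, ν) = 1)
    (h2 : gaugeTransform g U (y.shift μ, ν) = 1) :
    gaugeTransform g U (y.shift ν, μ) =
      (g y * plaquetteHolonomy U y μ ν * (g y)⁻¹)⁻¹ * gaugeTransform g U (y, μ) := by
  -- adapted from `CombGauge.gaugeTransform_shift_eq` (HeatSlicedQuarks…StubCombGaugeAux.lean)
  have hshift : (y.shift μ).shift ν = (y.shift ν).shift μ := by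
    simp only [QuantumFieldTheory.Site.shift, add_assoc,
      add_comm (Pi.single (M := fun _ => ZMod L) μ 1)]
  simp only [gaugeTransform, plaquetteHolonomy] at h1 h2 ⊢
  rw [mul_inv_eq_one] at h1 h2
  rw [← hshift, ← h1, ← h2]
  group

/-! ### Moving the cell links onto the tree -/

/-- **Comb bound on the cell** (the axial induction).  For a parametrisation `site` of the sites near
the cell by offsets compatible with shifts, a gauge `g` gauging the tree links to `1` and a common bound
`S ≥ 0` for the deficits of the cell plaquettes, a cell link `(site q, μ)` whose offset vanishes in the
coordinates `i > μ` with `i ≥ k` has deficit at most `(2^{k+1} - 2) S`: peel off the axis `ν = k` if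
`q_ν = 1` by the transport identity, at the cost `d(P⁻¹ W) ≤ 2 d(P) + 2 d(W)`. -/
private theorem link_bound {N L : ℕ} (V : GaugeConfig 4 L (unitaryGroup (Fin N) ℂ))
    (site : (Fin 4 → ℕ) → Site 4 L) (g : Site 4 L → unitaryGroup (Fin N) ℂ) (S : ℝ) (hS : 0 ≤ S)
    (hsite : ∀ (m : Fin 4 → ℕ) (μ : Fin 4),
      site (m + Pi.single μ 1) = QuantumFieldTheory.Site.shift (site m) μ)
    (hP : ∀ (q : Fin 4 → ℕ) (μ ν : Fin 4), μ < ν → (∀ i, q i ≤ 1) → q μ = 0 → q ν = 0 →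
      (N : ℝ) - (↑(plaquetteHolonomy V (site q) μ ν) : Matrix (Fin N) (Fin N) ℂ).trace.re ≤ S)
    (htl : ∀ (q : Fin 4 → ℕ) (μ : Fin 4), (∀ i, q i ≤ 1) → q μ = 0 → (∀ i, μ < i → q i = 0) →
      gaugeTransform g V (site q, μ) = 1) (k : ℕ) :
    ∀ (μ : Fin 4) (q : Fin 4 → ℕ), (∀ i, q i ≤ 1) → q μ = 0 →
      (∀ i : Fin 4, k ≤ i.val → μ < i → q i = 0) →
      (N : ℝ) - (↑(gaugeTransform g V (site q, μ)) : Matrix (Fin N) (Fin N) ℂ).trace.re ≤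
        (2 ^ (k + 1) - 2) * S := by
  induction k with
  | zero =>
    intro μ q hq hqμ htree
    rw [htl q μ hq hqμ fun i hi => htree i (Nat.zero_le _) hi]
    simp only [OneMemClass.coe_one, trace_one, Fintype.card_fin, Complex.natCast_re, sub_self]
    norm_num
  | succ k ih =>
    intro μ q hq hqμ htree
    have hmono : ((2 : ℝ) ^ (k + 1) - 2) * S ≤ (2 ^ (k + 1 + 1) - 2) * S := mul_le_mul_of_nonneg_right
      (by rw [pow_succ (2 : ℝ) (k + 1)]; linarith [pow_pos (zero_lt_two' ℝ) (k + 1)]) hS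
    by_cases hk : k < 4
    · obtain ⟨ν, hν⟩ : ∃ ν : Fin 4, ν.val = k := ⟨⟨k, hk⟩, rfl⟩
      have hup : ∀ i : Fin 4, k ≤ i.val → i ≠ ν → k + 1 ≤ i.val := fun i hi hne => by
        have : i.val ≠ ν.val := fun e => hne (Fin.ext e); omega
      by_cases hμν : μ < ν
      · by_cases hqν : q ν = 0
        · refine (ih μ q hq hqμ fun i hi hμi => ?_).trans hmono
          by_cases h : i = ν
          · rw [h]; exact hqν
          · exact htree i (hup i hi h) hμi
        · -- peel off the axis `ν`: `q = q' + e_ν` with `q'` one axis closer to the tree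
          have hq1 : q ν = 1 := by have := hq ν; omega
          set q' : Fin 4 → ℕ := Function.update q ν 0 with hq'
          have hq'i : ∀ i, i ≠ ν → q' i = q i := fun i h => by rw [hq', Function.update_of_ne h]
          have hq'ν : q' ν = 0 := by rw [hq', Function.update_self]
          have hqq' : q = q' + Pi.single ν 1 := by
            funext i
            by_cases h : i = ν
            · rw [h, Pi.add_apply, hq'ν, Pi.single_eq_same, hq1]
            · rw [Pi.add_apply, hq'i i h, Pi.single_eq_of_ne h, add_zero]
          have hq'le : ∀ i, q' i ≤ 1 := fun i => by
            by_cases h : i = ν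
            · rw [h, hq'ν]; exact zero_le_one
            · rw [hq'i i h]; exact hq i
          have hq'μ : q' μ = 0 := by rw [hq'i μ hμν.ne]; exact hqμ
          have hq'tree : ∀ i, ν < i → q' i = 0 := fun i hi => by
            rw [hq'i i hi.ne']; exact htree i (by have := Fin.lt_def.mp hi; omega) (hμν.trans hi)
          -- the two `ν`-links of the plaquette `(site q'; μ, ν)` are tree links
          have h1 : gaugeTransform g V (site q', ν) = 1 := htl q' ν hq'le hq'ν hq'tree
          have h2 : gaugeTransform g V (QuantumFieldTheory.Site.shift (site q') μ, ν) = 1 := by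
            rw [← hsite]
            refine htl _ ν (fun i => ?_) ?_ (fun i hi => ?_)
            · by_cases h : i = μ
              · rw [h, Pi.add_apply, Pi.single_eq_same, hq'μ]
              · rw [Pi.add_apply, Pi.single_eq_of_ne h, add_zero]; exact hq'le i
            · rw [Pi.add_apply, Pi.single_eq_of_ne hμν.ne', add_zero, hq'ν]
            · rw [Pi.add_apply, Pi.single_eq_of_ne (hμν.trans hi).ne', add_zero, hq'tree i hi]
          have key := gaugeTransform_shift_eq g V (site q') μ ν h1 h2
          rw [← hsite, ← hqq'] at key
          have hih : (N : ℝ) - (↑(gaugeTransform g V (site q', μ)) :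
              Matrix (Fin N) (Fin N) ℂ).trace.re ≤ (2 ^ (k + 1) - 2) * S := by
            refine ih μ q' hq'le hq'μ fun i hi hμi => ?_
            by_cases h : i = ν
            · rw [h, hq'ν]
            · rw [hq'i i h]; exact htree i (hup i hi h) hμi
          have hpl := hP q' μ ν hμν hq'le hq'μ hq'ν
          have hmul := deficit_mul_le'
            (g (site q') * plaquetteHolonomy V (site q') μ ν * (g (site q'))⁻¹)⁻¹
            (gaugeTransform g V (site q', μ))
          rw [re_trace_inv, re_trace_conj, ← key] at hmul
          linarith [show 2 * S + 2 * ((2 ^ (k + 1) - 2) * S) = ((2 : ℝ) ^ (k + 1 + 1) - 2) * S by ring]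
      · exact (ih μ q hq hqμ fun i hi hμi => htree i (hup i hi fun e => hμν (e ▸ hμi)) hμi).trans
          hmono
    · exact (ih μ q hq hqμ fun i hi hμi => htree i (by have := i.isLt; omega) hμi).trans hmono

/-! ### The statement -/

/-- **Cell gauge, all `N` (G3).**  There is an absolute constant `C` (here `1920`) such that for every
colour number `N`, on every torus `(ℤ/L)⁴`, `L ≥ 4`, for every `U(N)` configuration `V` and every
corner `c` some gauge `g` makes the total deficit of the `32` links of the closed unit hypercube at `c`
at most `C` times the total deficit of its `24` plaquettes — with no smallness assumption and no
dependence on `N`. -/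
theorem stub_cellGaugeAllN : ∃ C : ℝ, ∀ (N L : ℕ) [NeZero L], 4 ≤ L → ∀ (V : GaugeConfig 4 L (Matrix.unitaryGroup (Fin N) ℂ)) (c : Site 4 L), ∃ g : Site 4 L → Matrix.unitaryGroup (Fin N) ℂ, (∑ e ∈ Finset.univ.filter (fun e : Edge 4 L => (∀ ν, (e.1 ν - c ν).val ≤ 1) ∧ (e.1 e.2 - c e.2).val = 0), ((N : ℝ) - (((gaugeTransform g V e : Matrix.unitaryGroup (Fin N) ℂ) : Matrix (Fin N) (Fin N) ℂ)).trace.re)) ≤ C * ∑ p ∈ Finset.univ.filter (fun p : Plaquette 4 L => (∀ ν, (p.1 ν - c ν).val ≤ 1) ∧ (p.1 p.2.1.1 - c p.2.1.1).val = 0 ∧ (p.1 p.2.1.2 - c p.2.1.2).val = 0), ((N : ℝ) - (((plaquetteHolonomy V p.1 p.2.1.1 p.2.1.2 : Matrix.unitaryGroup (Fin N) ℂ) : Matrix (Fin N) (Fin N) ℂ)).trace.re) := by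
  refine ⟨1920, fun N L _ hL V c => ?_⟩
  obtain ⟨g, hg⟩ := exists_treeGauge hL V c
  refine ⟨g, ?_⟩
  -- the two filters and the plaquette sum `S`
  set EF := Finset.univ.filter (fun e : Edge 4 L =>
    (∀ ν, (e.1 ν - c ν).val ≤ 1) ∧ (e.1 e.2 - c e.2).val = 0) with hEF
  set PF := Finset.univ.filter (fun p : Plaquette 4 L =>
    (∀ ν, (p.1 ν - c ν).val ≤ 1) ∧ (p.1 p.2.1.1 - c p.2.1.1).val = 0 ∧
      (p.1 p.2.1.2 - c p.2.1.2).val = 0) with hPF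
  set S := ∑ p ∈ PF,
    ((N : ℝ) - (((plaquetteHolonomy V p.1 p.2.1.1 p.2.1.2 : unitaryGroup (Fin N) ℂ) :
      Matrix (Fin N) (Fin N) ℂ)).trace.re) with hSdef
  have hS0 : 0 ≤ S := Finset.sum_nonneg fun p _ => deficit_nonneg _
  -- cell sites by offsets from the corner
  have hval : ∀ q : Fin 4 → ℕ, (∀ i, q i ≤ 1) → ∀ i,
      ((c + fun j => ((q j : ℕ) : ZMod L)) i - c i).val = q i := by
    intro q hq i
    simp only [Pi.add_apply, add_sub_cancel_left]
    exact ZMod.val_cast_of_lt (by have := hq i; omega)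
  have hsite : ∀ (m : Fin 4 → ℕ) (μ : Fin 4),
      (c + fun i => (((m + Pi.single μ 1 : Fin 4 → ℕ) i : ℕ) : ZMod L)) =
        QuantumFieldTheory.Site.shift (c + fun i => ((m i : ℕ) : ZMod L)) μ := by
    intro m μ
    simp only [QuantumFieldTheory.Site.shift]; rw [add_assoc]; congr 1; funext i
    by_cases h : i = μ
    · subst h; simp
    · simp [Pi.single_eq_of_ne h]
  -- every cell plaquette costs at most `S`
  have hP : ∀ (q : Fin 4 → ℕ) (μ ν : Fin 4), μ < ν → (∀ i, q i ≤ 1) → q μ = 0 → q ν = 0 →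
      (N : ℝ) - (↑(plaquetteHolonomy V (c + fun j => ((q j : ℕ) : ZMod L)) μ ν) :
        Matrix (Fin N) (Fin N) ℂ).trace.re ≤ S := by
    intro q μ ν hμν hq hqμ hqν
    have hmem : ((c + fun j => ((q j : ℕ) : ZMod L)), (⟨(μ, ν), hμν⟩ : {p : Fin 4 × Fin 4 // p.1 < p.2}))
        ∈ PF := by
      refine Finset.mem_filter.mpr ⟨Finset.mem_univ _, ?_⟩
      dsimp only
      refine ⟨fun i => ?_, ?_, ?_⟩
      · rw [hval q hq i]; exact hq i
      · rw [hval q hq μ]; exact hqμ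
      · rw [hval q hq ν]; exact hqν
    have h := Finset.single_le_sum (f := fun p : Plaquette 4 L =>
      (N : ℝ) - (((plaquetteHolonomy V p.1 p.2.1.1 p.2.1.2 : unitaryGroup (Fin N) ℂ) :
        Matrix (Fin N) (Fin N) ℂ)).trace.re)
      (fun p _ => deficit_nonneg _) hmem
    exact h
  -- the comb bound with all four axes cleared: `30 S` per cell link
  have hlink : ∀ (μ : Fin 4) (q : Fin 4 → ℕ), (∀ i, q i ≤ 1) → q μ = 0 →
      (N : ℝ) - (↑(gaugeTransform g V ((c + fun j => ((q j : ℕ) : ZMod L)), μ)) :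
        Matrix (Fin N) (Fin N) ℂ).trace.re ≤ 30 * S := by
    intro μ q hq hqμ
    have h := link_bound V (fun m => c + fun j => ((m j : ℕ) : ZMod L)) g S hS0 hsite hP hg 4 μ q hq
      hqμ (fun i hi _ => absurd i.isLt (by omega))
    rwa [show ((2 : ℝ) ^ (4 + 1) - 2) = 30 by norm_num] at h
  have hE : ∀ e ∈ EF,
      (N : ℝ) - (↑(gaugeTransform g V e) : Matrix (Fin N) (Fin N) ℂ).trace.re ≤ 30 * S := by
    rintro ⟨x, μ⟩ he
    obtain ⟨hcell, hμ⟩ := (Finset.mem_filter.mp he).2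
    have hx : (c + fun j => (((x j - c j).val : ℕ) : ZMod L)) = x := by
      funext j; simp only [Pi.add_apply, ZMod.natCast_zmod_val]; abel
    have h := hlink μ (fun j => (x j - c j).val) hcell hμ
    rwa [hx] at h
  -- at most `64` cell links
  have hcard : EF.card ≤ 64 := by
    have h64 : ((Fintype.piFinset fun _ : Fin 4 => Finset.range 2) ×ˢ
        (Finset.univ : Finset (Fin 4))).card = 64 := by
      rw [Finset.card_product, Fintype.card_piFinset, Finset.prod_const, Finset.card_range,
        Finset.card_univ, Fintype.card_fin]
      rfl
    rw [← h64]
    refine Finset.card_le_card_of_injOn (fun e : Edge 4 L => (fun ν => (e.1 ν - c ν).val, e.2)) ?_ ?_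
    · intro e he
      rw [Finset.mem_coe] at he ⊢
      obtain ⟨hcell, -⟩ := (Finset.mem_filter.mp he).2
      simp only [Finset.mem_product, Fintype.mem_piFinset, Finset.mem_range, Finset.mem_univ,
        and_true]
      exact fun ν => Nat.lt_succ_of_le (hcell ν)
    · intro e₁ _ e₂ _ h
      simp only [Prod.mk.injEq] at h
      exact Prod.ext (funext fun ν => sub_left_inj.mp (ZMod.val_injective L (congr_fun h.1 ν))) h.2
  -- summation
  calc ∑ e ∈ EF, ((N : ℝ) - (↑(gaugeTransform g V e) : Matrix (Fin N) (Fin N) ℂ).trace.re)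
      ≤ ∑ e ∈ EF, 30 * S := Finset.sum_le_sum hE
    _ ≤ 64 * (30 * S) := by
        rw [Finset.sum_const, nsmul_eq_mul]
        exact mul_le_mul_of_nonneg_right (by exact_mod_cast hcard) (mul_nonneg (by norm_num) hS0)
    _ = 1920 * S := by ring

end

end Summit.QuantumFields.QCD.Cruxes.FlatCellOptimal.CellGauge
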